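import Mathlib
import Summits.ValiantsHypothesis.ValiantsHypothesis.Theorems.LiouvilleSarnakAlignedTypeICharactersMod2nBilinearSievePostnikovFormulaOfLog
import HarnessLib

/-!
# Route LiouvilleSarnak — support `AlignedTypeI` (stmt-ValiantsHypothesis-21040), line `characters_mod_2n`:
# the multiplier in Postnikov's formula is odd for a primitive character

Fifth brick for `HS`.  In Postnikov's formula `χ(1 + 2^τ v) = e(cΛ(v)/2^{n+τ})` (`…PostnikovFormulaOfLog.lean`) the
multiplier `c` is ODD when `χ` is primitive mod `2^{n+τ}` (`n ≥ 1`, `τ ≥ 2`): otherwise `χ(g^{2^{n-1}}) = e(cℓ/2) = 1`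
with `g^{2^{n-1}} = (1 + 2^τ)^{2^{n-1}} ≡ 1 + 2^{n+τ-1}`, so `χ` is trivial on the kernel `{1, 1 + 2^{n+τ-1}}` of
`(ℤ/2^{n+τ})ˣ → (ℤ/2^{n+τ-1})ˣ` and factors through `2^{n+τ-1}`.  This is what makes the denominators of the
coefficients `α_m = c·(−1)^{m−1}2^{mτ−v₂(m)}u_m/2^{n+τ}` of the Postnikov phase EXACTLY `2^{n+τ−mτ+v₂(m)}` (the
"good factors" of the Korobov bound).

* `apply_one_add_half_level_ne_one` — a primitive `χ` mod `2^{j}` (`j ≥ 2`) has `χ(1 + 2^{j-1}) ≠ 1`;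
* `one_add_two_pow_pow_two_pow` — `(1 + 2^τ)^{2^{n}} = 1 + 2^{n+τ} + 2^{n+τ+1}y` (`τ ≥ 2`);
* `odd_of_postnikov_formula` — ★ the multiplier `c` of any Postnikov formula for a primitive `χ` is odd.

HONEST FRAMING. Helper lemmas only (unconditional); the leaf `AlignedTypeI` is NOT closed here; nothing bears on
`VP ≠ VNP` (NOT proved).
-/

set_option linter.dupNamespace false

noncomputable section

namespace Summit.ValiantsHypothesis.ValiantsHypothesis.Theorems.LiouvilleSarnak.AlignedTypeI.CharactersModTwoN

open Finset Complex

/-- **A primitive character mod `2^{e+2}` is non-trivial at `1 + 2^{e+1}`** (else it is trivial on the kernel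
`{1, 1 + 2^{e+1}}` of the reduction to `2^{e+1}` and factors through it). [folklore] -/
theorem apply_one_add_half_level_ne_one {j : ℕ} (hj : 2 ≤ j) (χ : DirichletCharacter ℂ (2 ^ j))
    (hχ : χ.IsPrimitive) : χ ((1 + 2 ^ (j - 1) : ℕ) : ZMod (2 ^ j)) ≠ 1 := by
  obtain ⟨e, rfl⟩ := Nat.exists_eq_add_of_le hj
  rw [show 2 + e - 1 = e + 1 by omega]
  haveI : NeZero (2 ^ (2 + e)) := ⟨pow_ne_zero _ two_ne_zero⟩
  intro h1
  rw [Nat.add_comm 1 (2 ^ (e + 1))] at h1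
  have hdvd : 2 ^ (e + 1) ∣ 2 ^ (2 + e) := pow_dvd_pow 2 (by omega)
  have hfac : χ.FactorsThrough (2 ^ (e + 1)) := by
    rw [DirichletCharacter.factorsThrough_iff_ker_unitsMap hdvd]
    intro u hu
    rw [MonoidHom.mem_ker, Units.ext_iff, ZMod.unitsMap_val, ← ZMod.natCast_val, Units.val_one] at hu
    rw [MonoidHom.mem_ker, Units.ext_iff, MulChar.coe_toUnitHom, Units.val_one]
    set a : ℕ := (u : ZMod (2 ^ (2 + e))).val with ha
    have ha_lt : a < 2 ^ (2 + e) := ZMod.val_lt _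
    set m : ℕ := 2 ^ (e + 1) with hm
    have hm1 : 1 < m := by rw [hm]; exact Nat.one_lt_two_pow (by omega)
    have hjm : 2 ^ (2 + e) = 2 * m := by rw [hm, show 2 + e = e + 1 + 1 by omega, pow_succ]; ring
    have hu' : a % m = 1 := by
      have h1' : ((a : ℕ) : ZMod m) = ((1 : ℕ) : ZMod m) := by rw [Nat.cast_one]; exact hu
      rw [ZMod.natCast_eq_natCast_iff'] at h1'
      rwa [Nat.mod_eq_of_lt hm1] at h1'
    have hua : (u : ZMod (2 ^ (2 + e))) = (a : ZMod (2 ^ (2 + e))) := (ZMod.natCast_zmod_val _).symm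
    have hcases : a = 1 ∨ a = m + 1 := by
      have h1'' := Nat.div_add_mod a m
      have h2 : a / m < 2 := by
        rw [Nat.div_lt_iff_lt_mul (by omega)]; omega
      interval_cases (a / m) <;> omega
    rcases hcases with h | h
    · rw [hua, h, Nat.cast_one, map_one]
    · rw [hua, h]
      exact h1
  have hcd : χ.conductor ∣ 2 ^ (e + 1) :=
    DirichletCharacter.conductor_dvd_of_mem_conductorSet χ
      ((DirichletCharacter.mem_conductorSet_iff χ).mpr hfac)
  rw [DirichletCharacter.isPrimitive_def] at hχ
  rw [hχ] at hcd
  have h1' := Nat.le_of_dvd (by positivity) hcd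
  have h2 : 2 ^ (e + 1) < 2 ^ (2 + e) := Nat.pow_lt_pow_right (by norm_num) (by omega)
  omega

/-- `(1 + 2^τ)^{2^{n}} ≡ 1 + 2^{n+τ} (mod 2^{n+τ+1})` in the form: `(1 + 2^τ)^{2^n} = 1 + 2^{n+τ} + 2^{n+τ+1} y` for
some `y ∈ ℕ` (`τ ≥ 2`; Mathlib's `ZMod.exists_one_add_mul_pow_prime_pow_eq`). [folklore] -/
theorem one_add_two_pow_pow_two_pow {τ : ℕ} (hτ : 2 ≤ τ) (n : ℕ) :
    ∃ y : ℕ, (1 + 2 ^ τ) ^ (2 ^ n) = 1 + 2 ^ (n + τ) + 2 ^ (n + τ + 1) * y := by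
  have hvu : (2 : ℕ) ∣ 2 ^ τ := dvd_pow_self 2 (by omega)
  have hpuv : 2 * 2 ^ τ * 2 ∣ (2 ^ τ) ^ 2 := by
    rw [show 2 * 2 ^ τ * 2 = 2 ^ (τ + 2) by ring, ← pow_mul]
    exact pow_dvd_pow 2 (by omega)
  obtain ⟨y, hy⟩ := ZMod.exists_one_add_mul_pow_prime_pow_eq (R := ℕ) Nat.prime_two hvu hpuv 1 n
  refine ⟨y, ?_⟩
  rw [mul_one] at hy
  rw [hy]
  ring

/-- ★ **The multiplier of a Postnikov formula for a PRIMITIVE character is odd.**  If `Λ` is a homomorphism mod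
`2^{n+τ}` on `1 + 2^τℕ` (`τ ≥ 2`, `n ≥ 1`) with `Λ(1) = 2^τℓ`, `ℓ` odd, and `χ(1 + 2^τ v) = e(cΛ(v)/2^{n+τ})` for all `v`
for a primitive `χ` mod `2^{n+τ}`, then `c` is odd. [folklore] -/
theorem odd_of_postnikov_formula {τ : ℕ} (hτ : 2 ≤ τ) {n : ℕ} (hn : 1 ≤ n) (Λ : ℕ → ℤ)
    (hhom : ∀ a b : ℕ, ((Λ (a + b + 2 ^ τ * a * b) : ℤ) : ZMod (2 ^ (n + τ))) =
      (Λ a : ZMod (2 ^ (n + τ))) + (Λ b : ZMod (2 ^ (n + τ))))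
    {ℓ : ℕ} (hone : Λ 1 = 2 ^ τ * ℓ) (χ : DirichletCharacter ℂ (2 ^ (n + τ)))
    (hχ : χ.IsPrimitive) {c : ℕ}
    (hc : ∀ v : ℕ, χ ((1 + 2 ^ τ * v : ℕ) : ZMod (2 ^ (n + τ))) =
      Complex.exp (2 * Real.pi * I * ((c : ℂ) * (Λ v : ℂ)) / (2 : ℂ) ^ (n + τ))) :
    Odd c := by
  by_contra hodd
  rw [Nat.not_odd_iff_even] at hodd
  obtain ⟨c', hc'⟩ := hodd
  obtain ⟨n', rfl⟩ := Nat.exists_eq_add_of_le hn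
  -- the exponent `v = w_{2^{n'}}`: `1 + 2^τ v = g^{2^{n'}} = 1 + 2^{n'+τ} + 2^{n'+τ+1} y`
  set v : ℕ := ((1 + 2 ^ τ) ^ (2 ^ n') - 1) / 2 ^ τ with hv
  have hgv : 1 + 2 ^ τ * v = (1 + 2 ^ τ) ^ (2 ^ n') := one_add_two_pow_mul_powShift τ (2 ^ n')
  obtain ⟨y, hy⟩ := one_add_two_pow_pow_two_pow hτ n'
  -- `Λ v ≡ 2^{n'} Λ 1 = 2^{n'+τ} ℓ`
  have hΛ : ((Λ v : ℤ) : ZMod (2 ^ (1 + n' + τ))) =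
      ((2 ^ n' : ℕ) : ZMod (2 ^ (1 + n' + τ))) * (Λ 1 : ZMod (2 ^ (1 + n' + τ))) :=
    log_powShift_eq_smul Λ hhom (2 ^ n')
  have hΛ' : ((Λ v : ℤ) : ZMod (2 ^ (1 + n' + τ))) = (((2 ^ n' * (2 ^ τ * ℓ) : ℕ) : ℤ) : ZMod (2 ^ (1 + n' + τ))) := by
    rw [hΛ, hone]; push_cast; ring
  rw [ZMod.intCast_eq_intCast_iff_dvd_sub] at hΛ'
  obtain ⟨t, ht⟩ := hΛ'
  -- the value `χ(1 + 2^τ v) = 1`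
  have hval : χ ((1 + 2 ^ τ * v : ℕ) : ZMod (2 ^ (1 + n' + τ))) = 1 := by
    rw [hc v]
    apply Complex.exp_eq_one_iff.2
    refine ⟨(c' : ℤ) * ℓ - (c : ℤ) * t, ?_⟩
    have htC : (((2 ^ n' * (2 ^ τ * ℓ) : ℕ) : ℤ) : ℂ) - (Λ v : ℂ) = ((2 ^ (1 + n' + τ) : ℕ) : ℤ) * (t : ℂ) := by
      exact_mod_cast ht
    push_cast at htC ⊢
    have hΛv : ((Λ v : ℤ) : ℂ) = (2 : ℂ) ^ n' * ((2 : ℂ) ^ τ * (ℓ : ℂ)) - (2 : ℂ) ^ (1 + n' + τ) * (t : ℂ) := by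
      linear_combination -htC
    have hcC : (c : ℂ) = (c' : ℂ) + (c' : ℂ) := by exact_mod_cast hc'
    rw [hΛv, hcC]
    have h2 : (2 : ℂ) ^ (1 + n' + τ) ≠ 0 := pow_ne_zero _ two_ne_zero
    field_simp
    ring
  -- but `1 + 2^τ v ≡ 1 + 2^{n'+τ}` and `χ` is primitive
  have hcast : ((1 + 2 ^ τ * v : ℕ) : ZMod (2 ^ (1 + n' + τ))) =
      ((1 + 2 ^ (1 + n' + τ - 1) : ℕ) : ZMod (2 ^ (1 + n' + τ))) := by
    rw [hgv, hy, ZMod.natCast_eq_natCast_iff', show 1 + n' + τ - 1 = n' + τ by omega,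
      show n' + τ + 1 = 1 + n' + τ by omega, Nat.add_mul_mod_self_left]
  have hne := apply_one_add_half_level_ne_one (j := 1 + n' + τ) (by omega) χ hχ
  rw [← hcast] at hne
  exact hne hval

end Summit.ValiantsHypothesis.ValiantsHypothesis.Theorems.LiouvilleSarnak.AlignedTypeI.CharactersModTwoN
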